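/-
Copyright (c) 2026. All rights reserved.
Released under Apache 2.0 license as described in the file LICENSE.
Authors: abc-iut cell, prover seat abc-iut-L4-t6 (gen 14; cell row S3 «ARC-LTIMES-CARRIER», L4-lead m169/m170), over
abc-iut-L4-t3's `⋉`-successor interface (`Ltimes/LogFrobeniusCompatibility.lean`), abc-iut-L4-t8's `𝒞^hol_{TH⊞}`
(`ArchimedeanHolGroupPairs*.lean`), abc-iut-w5-d038's archimedean `η⊢` (`ArchimedeanHolGroupPairsEta*.lean`),
abc-iut-w6-d025's arc chart (`AutHolFieldFunctorMonoAnalyticization.lean`) and abc-iut-w4-d095's `archGenuine`.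
-/
import Literature.AnabelianGeometry.AbsoluteAnabelian.Ltimes.LogFrobeniusCompatibility
import Literature.AnabelianGeometry.AbsoluteAnabelian.AutHolFieldFunctorMonoAnalyticization
import Literature.AnabelianGeometry.AbsoluteAnabelian.ArchimedeanHolGroupPairsEta
import Literature.AnabelianGeometry.AbsoluteAnabelian.ArchimedeanHolGroupPairsEtaTimes
import Literature.AnabelianGeometry.AbsoluteAnabelian.LogFrobeniusArchPlusNoGo
import HarnessLib

/-!
# [AbsTopIII] Def 5.4 (v)–(vii), Def 5.6 (iv), Cor 5.5 (iii): the `⋉`-carrier with GENUINE archimedean `⊞`-side —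
# `𝒩⊞_v := 𝒞^hol_{TH⊞}`, `λ⊞_{v,ν}`, `ι⊞_{v,ε}` on `Γ⃗^⋉_arc`, and the mono-analyticization `𝒞^hol_{TH⊞} → TM⊢ × TB⊞`

S. Mochizuki, *Topics in absolute anabelian geometry III: global reconstruction algorithms*, J. Math. Sci. Univ.
Tokyo 22 (2015) 939–1156 [MochizukiAbsTopIII2015]; locators `p.N` = pages of the author's manuscript
(`paper:url-5493eb38cbb7`): Def 5.4 (v) p. 127 (the archimedean graph `Γ⃗^log_arc = k∼ →(id) k∼ ↠ k^× ↪ k`; "the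
diagram `Γ⃗^⋉_arc` [= without `↪ k`] may be considered either as a diagram in `TH` or as a diagram in `TH⊞`"), Def 5.4
(vi) p. 128 (`λ⊞_{v,ν} : Th•_T[Z] → 𝒩⊞_v`, "natural functors `𝒞^hol_{TH⊞} → 𝒞^hol_TH → EA`"), Def 5.4 (vii) p. 128
(`ι⊞_{v,ε}` "for each edge `ε` of `Γ⃗^⋉_v`"), Cor 5.5 (iii) p. 131 ("`ι⊞_{v,ε}` … `ε` is an edge of `Γ⃗^⋉_v`"), Def 5.6
(ii)(c) p. 135 (`G_v := (𝒪^▷_{𝒜_{X_v}}, 𝒪^▷ ∩ ℝ_{>0}) ∈ TM⊢`), Def 5.6 (iv) p. 136 ("by pulling back to `M_k`, via the Kummer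
structure … the two one-parameter subgroups `S¹ × {1}`, `{1} × ℝ_{>0} ⊆ ℂ^×`, we obtain, in a natural way, an object of
`𝒞^{hol⊢}_{TB⊞}`"), Prop 5.8 (iv)/(v)/(vii) pp. 140–142 (`k∼(G)`, `k×(G)`, `An⊢[𝒩⊢⊞_w]`, `ψ^{An⊢⊞}_{w,ν}`), Cor 5.10
(iv)(c) p. 148 (the natural isomorphisms `η⊢_{v,ν}` between the paths `γ¹_{v,ν}` and `γ⁰_{v,ν}`).

## What this file builds (cell row S3 of the successor lane; abc-iut-L4-t3's owner verdict V2, L4-lead m162/m169/m170 (M1))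

The FROZEN interface `LogFrobeniusSetting` asks for `ι⊞` along the space-link inclusion `k^× ↪ k`; abc-iut-L4-t8 proved
that `𝒞^hol_{TH⊞}` has NO morphism there (`HolTFPair.isEmpty_lamTimesPlus_hom_lamSimPlus`) and abc-iut-L4-t3 proved that
over the frozen interface the `η⊢`-datum of Cor 5.10 (iv)(c) is therefore EMPTY at every carrier with print's archimedean
shapes (`LogFrobeniusArchPlusNoGo.lean`, ★★★ `isEmpty_monoTelecoreCoherence_archGenuineMonoAnChart`).  All archimedean
carriers of record hence collapse the `⊞`-side: `𝒩⊞_v = 𝒩_v := 𝒞^hol_TH` (honest limit (L1′) of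
`AutHolFieldFunctorMonoAnalyticization.lean`: the `TB⊞`-component of `𝒩⊞_v → 𝒩⊢⊞_v` is the CONSTANT `k∼`).  Over the
`⋉`-successor `LogFrobeniusSettingLtimes` (abc-iut-L4-t3, `ι⊞` on `Γ⃗^⋉_v` only, Cor 5.5 (iii)) the collapse is no longer
forced, and this file builds the carrier print describes:

* `archLamPlus 𝔄 b ν` — `λ⊞_{v,ν}` valued in `𝒞^hol_{TH⊞}` (abc-iut-L4-t8's `HolTHPlusPair 𝔄`): `k∼ ↦ λ⊞_∼ = (𝕏 ↶ (k,+))`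
  (`HolTFPair.lamSimPlus`) at the post-log, pre-log and space-link vertices, `k^× ↦ λ⊞_× = (𝕏 ↶ k^×)` (`lamTimesPlus`);
* `archIotaPlus 𝔄 b ε` — `ι⊞_{v,ε}` for the edges of `Γ⃗^⋉_arc` ONLY (`LogEdgeLtimes`): the identity along `k∼ →(id) k∼`,
  the shell arrow `exp_k : (k,+) ↠ k^×` AS A MORPHISM OF `𝒞^hol_{TH⊞}` (`HolTFPair.iotaTimesPlus`) along `k∼ ↠ k^×`; the
  clause `k^× ↪ k` is VACUOUS (`LogEdgeLtimes.isEmpty_toSpaceLink`);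
* `archMonoNplus 𝔄` — the mono-analyticization `𝒩⊞_v → 𝒩⊢⊞_v = TM⊢ × TB⊞` GENUINE IN BOTH COMPONENTS:
  `(𝕏 ↶ M) ↦ (G_𝕏, M^{TB⊞})`, `G_𝕏` by abc-iut-w6-d025's chart functor `AutHolFieldFunctor.toTMMono` (Def 5.6 (ii)(c)),
  `M^{TB⊞}` by abc-iut-L4-t8's `HolTHPlusPair.toTBPlus` (Def 5.6 (iv)) — this REMOVES (L1′);
* ★ `LogFrobeniusSettingLtimes.archGenuinePlus 𝔄 Vmod isArc` — the `⋉`-carrier: holomorphic rows and `An•`-rows =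
  abc-iut-w4-d095's `archGenuine` (`𝒳 := 𝒞^hol_TF`, `ℰ• := EA`, `An• := LinHol`), `𝒩⊞_v := 𝒞^hol_{TH⊞}`, `𝒩_v := 𝒞^hol_TH`,
  `𝒩⊞_v → 𝒩_v :=` abc-iut-L4-t8's `forgetTH`, `λ⊞`/`ι⊞` as above, mono-analytic rows = abc-iut-w6-d025's arc chart
  (`ℰ⊢ := TM⊢`, `An⊢ := AnArc` with `Th⊢ ⥲ An⊢` on the nose, `ψ^{An⊢⊞}_{w,ν} := ψArc`: `k∼(G)` at `pre`, `k×(G)` at `mult`),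
  `𝒩⊞_v → 𝒩⊢⊞_v := archMonoNplus`;
* `rfl`-API; ★ `archGenuinePlus_lam_forget` — the successor carrier LIFTS the carrier of record along
  `𝒞^hol_{TH⊞} → 𝒞^hol_TH` (`λ⊞_{v,ν} ⋙ forgetTH = archLam`, on the nose); `archGenuinePlus_ψOver` ("`ψ` lies over `ℰ⊢`", on
  the nose), `_monoN_toEmono_eq` / `_κAn₂_monoAn_eq` (rows 4 → 5 / 6 → 7 on the nose);
* ★★ `archGenuinePlus_shapes` — at this carrier `γ⁰_{v,mult}` IS circle-type and `γ⁰_{v,pre}` IS plane-type in `TB⊞` (print's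
  `k^× ⊃ S¹`, `k∼ ≅ ℝ²`): EXACTLY the pair of hypotheses under which abc-iut-L4-t3's `false_of_tbplus_shapes_arc` yields
  `False` over the FROZEN interface — `exists_ltimes_shapes` vs `not_exists_frozen_shapes`: the successor interface admits a
  print-shaped archimedean carrier, the frozen one admits none;
* §5: the remaining data of abc-iut-L4-t3's add-ons at the carrier, by identities — `archGenuinePlus_toEIso` (rows 4 → 5),
  `archGenuinePlus_anToEIso` (rows 6 → 7, the unit of `Th⊢ ⥲ An⊢`), `archGenuinePlus_ψOverIso` ("`ψ` over `ℰ⊢`"); and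
  `TMMono.anArcEquiv_unitIso_hom_app` / `_inv_app` (§0) — the unit of abc-iut-w6-d025's `Th⊢ ⥲ An⊢` has identity components
  (the last ingredient of the coherence "`η⊢` lies over `ℰ⊢`").

SEQUEL (`Ltimes/LogFrobeniusArchGenuinePlusEta.lean`): the natural isomorphisms `η⊢_{v,ν}` of Cor 5.10 (iv)(c) AT THIS CARRIER
— identity of `G_𝕏` on the `TM⊢`-component, abc-iut-w5-d038's `etaTilde⁻¹` / `etaTimes⁻¹` on the `TB⊞`-component, under
abc-iut-w5-d038's orientation cochain — and the coherence "`η⊢` lies over `ℰ⊢`"; then the packaging as the add-ons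
`MonoAnalyticizationHomotopies` / `MonoTelecoreCoherence` re-elaborated over the successor (relay slices T4a / T7a of
`Ltimes/`), every field being supplied here and in the sequel by name.

HONEST LIMITS (named): (L2) as in all archimedean carriers of record, the NONARCHIMEDEAN places of this setting read the
archimedean data (`λ⊞_∼`, identities, `k∼`) — stand-ins; over an all-archimedean index `isArc ≡ true` nothing on the
holomorphic or `ψ`-side is a stand-in; (L-N⊢) the tree types `TB⊞` but not `TB` (Def 5.6 (i) without one-parameter
subgroups), so `𝒩⊢_w` is read through its base `ℰ⊢ = TM⊢` and `𝒩⊢⊞_w → 𝒩⊢_w` is the first projection (`𝒩_v → 𝒩⊢_v := (𝕏 ↶ M)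
↦ G_𝕏`); Cor 5.10 reads `𝒩⊢_w` only through `ℰ⊢`; (L3)/(L4) of `LogFrobeniusArchGenuineMonoAn.lean` (`Orb(−)` read as the
identity — whence the cochain; one CAF chart per `𝕏`, functoriality proved).  MODEL-LEVEL (abc-iut-L4-t2's Aut-holomorphic
model over the interface `AutHolFieldFunctor`); a carrier of OUR successor typing, print unchanged; refereed pre-IUT
material; nothing here bears on [IUTchIII] Cor. 3.12; no side taken; typed ≠ proved.
-/

set_option autoImplicit false

noncomputable section

universe u

open CategoryTheory

namespace Literature.AnabelianGeometry.AbsoluteAnabelian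

/-! ## §0. The unit of `Th⊢ ⥲ An⊢[𝒩⊢⊞_w]` has identity components -/

namespace TMMono

/-- The unit of abc-iut-w6-d025's equivalence `anArcEquiv : TM⊢ ≌ An⊢` (built by `Equivalence.mk`, hence adjointified) has
identity components: read off the triangle law against the identity counit, the functor being faithful.
[cite: MochizukiAbsTopIII2015, Prop 5.8 (vii) p.141] -/
theorem anArcEquiv_unitIso_hom_app (G : TMMono.{u}) : anArcEquiv.unitIso.hom.app G = 𝟙 G := by
  have h1 : anArcEquiv.functor.map (anArcEquiv.unitIso.hom.app G) = 𝟙 _ :=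
    (Category.comp_id _).symm.trans (anArcEquiv.functor_unitIso_comp G)
  exact anArcEquiv.functor.map_injective (h1.trans (anArcEquiv.functor.map_id _).symm)

/-- Hence the inverse unit has identity components too. [cite: MochizukiAbsTopIII2015, Prop 5.8 (vii) p.141] -/
theorem anArcEquiv_unitIso_inv_app (G : TMMono.{u}) : anArcEquiv.unitIso.inv.app G = 𝟙 G :=
  (anArcEquiv.unitIso.app G).inv_ext ((Category.comp_id _).trans (anArcEquiv_unitIso_hom_app G))

end TMMono

namespace LogFrobeniusSettingLtimes

variable (𝔄 : AutHolFieldFunctor.{u})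

/-! ## §1. `λ⊞_{v,ν}` valued in `𝒞^hol_{TH⊞}` and `ι⊞_{v,ε}` on `Γ⃗^⋉_v` (Def 5.4 (v)–(vii), Cor 5.5 (iii)) -/

/-- **`λ⊞_{v,ν} : Th•_T[Z] → 𝒩⊞_v = 𝒞^hol_{TH⊞}`** at an ARCHIMEDEAN place (Def 5.4 (v)/(vi)): the post-log `k∼`, the pre-log
`k∼` and the space-link `k` go to `λ⊞_∼ = (𝕏 ↶ (k,+))` (abc-iut-L4-t8's `lamSimPlus`; `k∼ = (k,+)` in the model, and the
space-link and post-log functors are identified, Cor 5.5 p. 130), `k^×` goes to `λ⊞_× = (𝕏 ↶ k^×)` (`lamTimesPlus`); at a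
NONARCHIMEDEAN place of THIS setting every vertex goes to `λ⊞_∼` (stand-in, (L2)).
[cite: MochizukiAbsTopIII2015, Def 5.4 (vi) p. 128] -/
def archLamPlusBase : (b : Bool) → LogVertex b → (HolTFPair 𝔄 ⥤ HolTHPlusPair 𝔄)
  | true, ArchVertex.mult => HolTFPair.lamTimesPlus 𝔄
  | true, ArchVertex.postLog => HolTFPair.lamSimPlus 𝔄
  | true, ArchVertex.pre => HolTFPair.lamSimPlus 𝔄
  | true, ArchVertex.spaceLink => HolTFPair.lamSimPlus 𝔄
  | false, _ => HolTFPair.lamSimPlus 𝔄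

/-- `λ⊞_{v,ν}` on the interface's large categories (abc-iut-w4-d095's universe bookkeeping `Up`).
[cite: MochizukiAbsTopIII2015, Def 5.4 (vi) p. 128] -/
def archLamPlus (b : Bool) (ν : LogVertex b) : Up (HolTFPair 𝔄) ⥤ Up (HolTHPlusPair 𝔄) :=
  Up.liftF (archLamPlusBase 𝔄 b ν)

/-- `λ⊞_{v,ν}(𝕏 ↶ k)` has structure-orbispace `𝕏`, at every place and vertex (Def 5.4 (vi): "lies over `EA`").
[cite: MochizukiAbsTopIII2015, Def 5.4 (vi) p. 128] -/
theorem archLamPlusBase_toEA (b : Bool) (ν : LogVertex b) :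
    archLamPlusBase 𝔄 b ν ⋙ HolTHPlusPair.toEA 𝔄 = HolTFPair.toEA 𝔄 := by
  cases b
  · rfl
  · cases ν <;> rfl

/-- **`ι⊞_{v,ε}` before the twist, for the edges of `Γ⃗^⋉_v` ONLY** (Def 5.4 (vii), Cor 5.5 (iii)): at an ARCHIMEDEAN place,
along `k∼ →(id) k∼` the identity and along the shell arrow `k∼ ↠ k^×` the exponential `exp_k : (k,+) → k^×` AS A MORPHISM OF
`𝒞^hol_{TH⊞}` (abc-iut-L4-t8's `iotaTimesPlus`: "`Γ⃗^⋉_arc` … may be considered … as a diagram in `TH⊞`", Def 5.4 (v)); the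
space-link inclusion `k^× ↪ k` is NOT an edge of `Γ⃗^⋉_arc` (its clause is vacuous); at a NONARCHIMEDEAN place of THIS setting
the identity (stand-in, (L2)). [cite: MochizukiAbsTopIII2015, Def 5.4 (vii) p. 128] -/
def archIotaPlusCore : (b : Bool) → {ν₁ ν₂ : LogVertex b} → LogEdgeLtimes b ν₁ ν₂ →
    (archLamPlus 𝔄 b ν₁ ⟶ archLamPlus 𝔄 b ν₂)
  | true, _, _, ⟨ArchEdge.postLogId, _⟩ => 𝟙 _
  | true, _, _, ⟨ArchEdge.shell, _⟩ => Up.liftT (HolTFPair.iotaTimesPlus 𝔄)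
  | true, _, _, ⟨ArchEdge.multToSpaceLink, h⟩ => False.elim h
  | false, _, _, _ => 𝟙 _

/-- `Λ_ν ∘ λ⊞ = λ⊞` for the model's log-Frobenius functor (the identity in abc-iut-L4-t2's realisation), both values of
"is the post-log vertex". [cite: MochizukiAbsTopIII2015, Def 5.4 (vii) p. 128] -/
theorem frobeniusTwist_id_comp_plus (c : Bool) (F : Up (HolTFPair 𝔄) ⥤ Up (HolTHPlusPair 𝔄)) :
    frobeniusTwist (𝟭 (Up (HolTFPair 𝔄))) c ⋙ F = F := by
  cases c <;> rfl

/-- **`ι⊞_{v,ε} : λ⊞_{v,ν₁} ∘ Λ_{ν₁} → λ⊞_{v,ν₂}`** for `ε` an edge of `Γ⃗^⋉_v` (Def 5.4 (vii), Cor 5.5 (iii)): the canonical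
identification `Λ_{ν₁} ∘ λ⊞ = λ⊞` followed by `archIotaPlusCore`. [cite: MochizukiAbsTopIII2015, Def 5.4 (vii) p. 128] -/
def archIotaPlus (b : Bool) {ν₁ ν₂ : LogVertex b} (ε : LogEdgeLtimes b ν₁ ν₂) :
    frobeniusTwist (𝟭 (Up (HolTFPair 𝔄))) ν₁.isPostLog ⋙ archLamPlus 𝔄 b ν₁ ⟶ archLamPlus 𝔄 b ν₂ :=
  eqToHom (frobeniusTwist_id_comp_plus 𝔄 _ _) ≫ archIotaPlusCore 𝔄 b ε

/-- The space-link and post-log functors coincide (both `λ⊞_∼`), at every place — the proviso of Cor 5.5 p. 130.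
[cite: MochizukiAbsTopIII2015, Cor 5.5 p. 130] -/
theorem archLamPlus_spaceLink_eq_postLog (b : Bool) :
    archLamPlus 𝔄 b (LogVertex.spaceLink b) = archLamPlus 𝔄 b (LogVertex.postLog b) := by
  cases b <;> rfl

/-- `λ⊞_{v,ν}` lies over `EA` ON THE NOSE: `(𝕏 ↶ k) ↦ λ⊞_{v,ν}(𝕏 ↶ k) ↦ (𝕏 ↶ M) ↦ 𝕏` is `(𝕏 ↶ k) ↦ 𝕏` ("natural functors
`𝒞^hol_{TH⊞} → 𝒞^hol_TH → EA`", Def 5.4 (vi)). [cite: MochizukiAbsTopIII2015, Def 5.4 (vi) p. 128] -/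
def archLamPlusOver : (b : Bool) → (ν : LogVertex b) →
    (archLamPlus 𝔄 b ν ⋙ Up.liftF (HolTHPlusPair.forgetTH 𝔄) ⋙ Up.liftF (HolTHPair.toEA 𝔄) ≅ Up.liftF (HolTFPair.toEA 𝔄))
  | true, ArchVertex.mult => Iso.refl _
  | true, ArchVertex.postLog => Iso.refl _
  | true, ArchVertex.pre => Iso.refl _
  | true, ArchVertex.spaceLink => Iso.refl _
  | false, _ => Iso.refl _

/-- ★ **`λ⊞_{v,ν}` LIFTS the carrier of record along `𝒞^hol_{TH⊞} → 𝒞^hol_TH`, ON THE NOSE**: composed with abc-iut-L4-t8's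
`forgetTH` it IS abc-iut-w4-d095's `archLam` (`λ^∼` / `λ^×` of Def 4.1 (iv)), at every place and vertex.
[cite: MochizukiAbsTopIII2015, Def 5.4 (vi) p. 128] -/
theorem archLamPlus_forgetTH (b : Bool) (ν : LogVertex b) :
    archLamPlus 𝔄 b ν ⋙ Up.liftF (HolTHPlusPair.forgetTH 𝔄) = LogFrobeniusSetting.archLam 𝔄 b ν := by
  cases b
  · rfl
  · cases ν <;> rfl

/-! ## §2. The mono-analyticization `𝒩⊞_v → 𝒩⊢⊞_v`, genuine in both components (Def 5.6 (ii)(c), (iv)) -/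

/-- **`𝒩⊞_v = 𝒞^hol_{TH⊞} → 𝒩⊢⊞_v = TM⊢ × TB⊞`, `(𝕏 ↶ M) ↦ (G_𝕏, M^{TB⊞})`**: the `TM⊢`-component is `G_𝕏 = (𝒪^▷_{𝒜_𝕏},
𝒪^▷ ∩ ℝ_{>0})` (abc-iut-w6-d025's `toTMMono`, Def 5.6 (ii)(c)), the `TB⊞`-component is abc-iut-L4-t8's `toTBPlus` (Def 5.6
(iv): the one-parameter subgroups `S¹ × {1}`, `{1} × ℝ_{>0} ⊆ ℂ^×` pulled back along the Kummer structure), lifted one universe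
(`TBPlus.uliftFunctor`) to meet the arc chart's `𝒩⊢⊞_v`. [cite: MochizukiAbsTopIII2015, Def 5.6 (iv) p. 136] -/
def archMonoNplus : Up (HolTHPlusPair 𝔄) ⥤ TMMono.{u + 1} × TBPlus.{u + 1} :=
  inducedFunctor _ ⋙ (HolTHPlusPair.toEA 𝔄 ⋙ 𝔄.toTMMono).prod'
    (HolTHPlusPair.toTBPlus 𝔄 ⋙ TBPlus.uliftFunctor.{u + 1})

/-! ## §3. The `⋉`-carrier with genuine archimedean `⊞`-side -/

/-- ★ **The `⋉`-carrier with GENUINE archimedean `⊞`-side** (module docstring): `𝒳 := 𝒞^hol_TF`, `ℰ• := EA`, `An• := LinHol`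
(abc-iut-w4-d095's `archGenuine`, verbatim), `𝒩⊞_v := 𝒞^hol_{TH⊞}`, `𝒩_v := 𝒞^hol_TH`, `𝒩⊞_v → 𝒩_v := forgetTH`, `λ⊞ :=
archLamPlus`, `ι⊞ := archIotaPlus` (edges of `Γ⃗^⋉_v` only), `ℰ⊢ := TM⊢` with the chart functor `EA → TM⊢`, `𝒩⊢⊞_w := TM⊢ ×
TB⊞`, `𝒩⊢_w := TM⊢` (L-N⊢), `𝒩⊞_v → 𝒩⊢⊞_v := archMonoNplus` (GENUINE in both components), `𝒩_v → 𝒩⊢_v := (𝕏 ↶ M) ↦ G_𝕏`,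
`An⊢[𝒩⊢⊞] := AnArc`, `κ := anArcEquiv` (on the nose), `ψ^{An⊢⊞}_{w,ν} := ψArc`.
[cite: MochizukiAbsTopIII2015, Def 5.4 (v) p. 127] -/
def archGenuinePlus (Vmod : Type (u + 1)) (isArc : Vmod → Bool) : LogFrobeniusSettingLtimes Vmod isArc where
  X := Up (HolTFPair 𝔄)
  E := Up 𝔄.EA
  proj := Up.liftF (HolTFPair.toEA 𝔄)
  log := 𝟭 _
  logIsoId := Iso.refl _
  logOver := Iso.refl _
  Nplus _ := Up (HolTHPlusPair 𝔄)
  N _ := Up (HolTHPair 𝔄)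
  forget _ := Up.liftF (HolTHPlusPair.forgetTH 𝔄)
  toE _ := Up.liftF (HolTHPair.toEA 𝔄)
  lam v := archLamPlus 𝔄 (isArc v)
  lamOver v := archLamPlusOver 𝔄 (isArc v)
  lam_spaceLink_eq_postLog v := archLamPlus_spaceLink_eq_postLog 𝔄 (isArc v)
  iota v _ _ ε := archIotaPlus 𝔄 (isArc v) ε
  An := Up (LinHol 𝔄)
  κAn := Up.liftE (LinHol.linHolEquivalence 𝔄)
  φAn := Up.liftF (LinHol.φLH 𝔄)
  φAn_isEquivalence :=
    haveI := LinHol.φLH_isEquivalence 𝔄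
    (Up.liftE (LinHol.φLH 𝔄).asEquivalence).isEquivalence_functor
  ηAn := NatIso.ofComponents (fun X => InducedCategory.isoMk ((LinHol.ηLH 𝔄).app X.down))
    (fun f => InducedCategory.hom_ext ((LinHol.ηLH 𝔄).hom.naturality f.hom))
  κAn₂ := (Up.liftE (LinHol.linHolEquivalence 𝔄)).symm
  Emono := TMMono.{u + 1}
  monoAn := inducedFunctor _ ⋙ 𝔄.toTMMono
  NmonoPlus _ := TMMono.{u + 1} × TBPlus.{u + 1}
  Nmono _ := TMMono.{u + 1}
  forgetMono _ := CategoryTheory.Prod.fst _ _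
  toEmono _ := 𝟭 _
  monoNplus _ := archMonoNplus 𝔄
  monoN _ := inducedFunctor _ ⋙ HolTHPair.toEA 𝔄 ⋙ 𝔄.toTMMono
  monoHomotopy _ := Iso.refl _
  AnMono := TMMono.AnArc.{u + 1}
  κAnMono := TMMono.anArcEquiv.{u + 1}
  ψAnMono w ν := TMMono.ψArc (isArc w) ν.1

variable (Vmod : Type (u + 1)) (isArc : Vmod → Bool)

/-- `𝒳 = 𝒞^hol_TF` (abc-iut-L4-t2's model, lifted). [cite: MochizukiAbsTopIII2015, Def 5.4 (i) p. 125] -/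
theorem archGenuinePlus_X : (archGenuinePlus 𝔄 Vmod isArc).X = Up (HolTFPair 𝔄) := rfl

/-- `𝒩⊞_v = 𝒞^hol_{TH⊞}` — the GENUINE `⊞`-category, at every place. [cite: MochizukiAbsTopIII2015, Def 5.4 (vi) p. 128] -/
theorem archGenuinePlus_Nplus (v : Vmod) : (archGenuinePlus 𝔄 Vmod isArc).Nplus v = Up (HolTHPlusPair 𝔄) := rfl

/-- `λ⊞_{v,ν}` is `archLamPlus`. [cite: MochizukiAbsTopIII2015, Def 5.4 (vi) p. 128] -/
theorem archGenuinePlus_lam (v : Vmod) : (archGenuinePlus 𝔄 Vmod isArc).lam v = archLamPlus 𝔄 (isArc v) := rfl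

/-- `𝒩⊞_v → 𝒩⊢⊞_v` is `archMonoNplus` — genuine in both components. [cite: MochizukiAbsTopIII2015, Def 5.6 (iv) p. 136] -/
theorem archGenuinePlus_monoNplus (v : Vmod) : (archGenuinePlus 𝔄 Vmod isArc).monoNplus v = archMonoNplus 𝔄 := rfl

/-- `ψ^{An⊢⊞}_{w,ν}` IS abc-iut-w6-d025's genuine `ψArc` (`k∼(G)` at `pre`, `k×(G)` at `mult`).
[cite: MochizukiAbsTopIII2015, Prop 5.8 (vii) p. 141] -/
theorem archGenuinePlus_ψAnMono (w : Vmod) (ν : {ν : LogVertex (isArc w) // ν.IsCross}) :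
    (archGenuinePlus 𝔄 Vmod isArc).ψAnMono w ν = TMMono.ψArc (isArc w) ν.1 := rfl

/-- ★ **The holomorphic rows LIFT the carrier of record**: `λ⊞_{v,ν}` followed by `𝒩⊞_v → 𝒩_v` IS the `λ⊞_{v,ν} = λ^∼ / λ^×` of
abc-iut-w4-d095's `archGenuine` / abc-iut-w6-d025's `archGenuineMonoAnChart`, on the nose.
[cite: MochizukiAbsTopIII2015, Def 5.4 (vi) p. 128] -/
theorem archGenuinePlus_lam_forget (v : Vmod) (ν : LogVertex (isArc v)) :
    (archGenuinePlus 𝔄 Vmod isArc).lam v ν ⋙ (archGenuinePlus 𝔄 Vmod isArc).forget v =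
      (LogFrobeniusSetting.archGenuineMonoAnChart 𝔄 Vmod isArc).lam v ν :=
  archLamPlus_forgetTH 𝔄 (isArc v) ν

/-- **"`ψ^{An⊢⊞}_{w,ν}` lies over `ℰ⊢`" ON THE NOSE**: `ψ_ν ⋙ (𝒩⊢⊞_w → 𝒩⊢_w → ℰ⊢) = κ_{An⊢}⁻¹` (the (c)-datum of
abc-iut-L4-t3's add-on `MonoTelecoreCoherence`). [cite: MochizukiAbsTopIII2015, Prop 5.8 (vii) p. 141] -/
theorem archGenuinePlus_ψOver (w : Vmod) (ν : {ν : LogVertex (isArc w) // ν.IsCross}) :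
    (archGenuinePlus 𝔄 Vmod isArc).ψAnMono w ν ⋙ (archGenuinePlus 𝔄 Vmod isArc).forgetMono w ⋙
        (archGenuinePlus 𝔄 Vmod isArc).toEmono w =
      (archGenuinePlus 𝔄 Vmod isArc).κAnMono.inverse := rfl

/-- rows 4 → 5 ON THE NOSE: `𝒩_v → 𝒩⊢_v → ℰ⊢` and `𝒩_v → ℰ• → ℰ⊢` agree (`(𝕏 ↶ M) ↦ G_𝕏` both ways).
[cite: MochizukiAbsTopIII2015, Cor 5.10 p. 146] -/
theorem archGenuinePlus_monoN_toEmono_eq (v : Vmod) :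
    (archGenuinePlus 𝔄 Vmod isArc).monoN v ⋙ (archGenuinePlus 𝔄 Vmod isArc).toEmono v =
      (archGenuinePlus 𝔄 Vmod isArc).toE v ⋙ (archGenuinePlus 𝔄 Vmod isArc).monoAn := rfl

/-- rows 6 → 7 ON THE NOSE (`κ_{An•,2} = κ_{An•}⁻¹`). [cite: MochizukiAbsTopIII2015, Cor 5.10 p. 146] -/
theorem archGenuinePlus_κAn₂_monoAn_eq :
    (archGenuinePlus 𝔄 Vmod isArc).κAn₂.functor ⋙ (archGenuinePlus 𝔄 Vmod isArc).monoAn =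
      (archGenuinePlus 𝔄 Vmod isArc).κAn.inverse ⋙ (archGenuinePlus 𝔄 Vmod isArc).monoAn := rfl

/-- The mono-analyticization homotopy `𝒩⊞_v → 𝒩⊢⊞_v → 𝒩⊢_v ≅ 𝒩⊞_v → 𝒩_v → 𝒩⊢_v` of the carrier is the identity.
[cite: MochizukiAbsTopIII2015, Def 5.6 (iv) p. 136] -/
theorem archGenuinePlus_monoHomotopy (v : Vmod) : (archGenuinePlus 𝔄 Vmod isArc).monoHomotopy v = Iso.refl _ := rfl

/-! ## §4. Print's archimedean `TB⊞`-shapes are realised — and do not collide over the successor interface -/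

/-- ★★ **At the carrier, over an all-archimedean index, `γ⁰_{v,mult}` is CIRCLE-TYPE and `γ⁰_{v,pre}` is PLANE-TYPE in
`TB⊞`** (`k^× ⊃ S¹`, `k∼ ≅ ℝ²`; transported from abc-iut-w6-d025's `k×(G)`, `k∼(G)` along abc-iut-w5-d038's component
isomorphisms at the single object `x`) — exactly the hypotheses `hmult`, `hpre` of abc-iut-L4-t3's
`LogFrobeniusSetting.false_of_tbplus_shapes_arc`, for `R := (𝒩⊞_v → 𝒩⊢⊞_v) ⋙ pr₂`.
[cite: MochizukiAbsTopIII2015, Prop 5.8 (iv) p. 140] -/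
theorem archGenuinePlus_shapes (Vmod : Type (u + 1)) (v : Vmod) (x : Up (HolTFPair 𝔄)) :
    (((archGenuinePlus 𝔄 Vmod (fun _ => true)).monoNplus v ⋙ CategoryTheory.Prod.snd _ _).obj
        (((archGenuinePlus 𝔄 Vmod (fun _ => true)).lam v ArchVertex.mult).obj
          ((archGenuinePlus 𝔄 Vmod (fun _ => true)).log.obj x))).IsCircle ∧
      (((archGenuinePlus 𝔄 Vmod (fun _ => true)).monoNplus v ⋙ CategoryTheory.Prod.snd _ _).obj
        (((archGenuinePlus 𝔄 Vmod (fun _ => true)).lam v ArchVertex.pre).obj x)).IsPlane :=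
  ⟨TBPlus.IsCircle.of_iso TMMono.kTimesObj_isCircle
      (HolTFPair.etaTimesIso (fun _ => 1) x.down (fun _ => Or.inl rfl)).symm,
    TBPlus.IsPlane.of_iso TMMono.kTildeObj_isPlane
      (HolTFPair.etaTildeIso (fun _ => 1) x.down (fun _ => Or.inl rfl)).symm⟩

/-- **The successor interface ADMITS a carrier with print's archimedean `TB⊞`-shapes** under some `TB⊞`-reading of `𝒩⊞_v`
(this file's, with `R := (𝒩⊞_v → 𝒩⊢⊞_v) ⋙ pr₂`), as soon as `𝒞^hol_TF` has an object …
[cite: MochizukiAbsTopIII2015, Def 5.4 (v) p. 127] -/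
theorem exists_ltimes_shapes (Vmod : Type (u + 1)) [Nonempty Vmod] [Nonempty (HolTFPair 𝔄)] :
    ∃ (Lt : LogFrobeniusSettingLtimes Vmod (fun _ => true)) (v : Vmod) (R : Lt.Nplus v ⥤ TBPlus.{u + 1}) (x : Lt.X),
      (R.obj ((Lt.lam v ArchVertex.mult).obj (Lt.log.obj x))).IsCircle ∧
        (R.obj ((Lt.lam v ArchVertex.pre).obj x)).IsPlane :=
  ⟨archGenuinePlus 𝔄 Vmod (fun _ => true), Classical.arbitrary Vmod,
    (archGenuinePlus 𝔄 Vmod (fun _ => true)).monoNplus (Classical.arbitrary Vmod) ⋙ CategoryTheory.Prod.snd _ _,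
    ULift.up (Classical.arbitrary (HolTFPair 𝔄)),
    archGenuinePlus_shapes 𝔄 Vmod _ _⟩

/-- … whereas **the FROZEN interface admits NONE** (abc-iut-L4-t3's `false_of_tbplus_shapes_arc`: its `ι⊞` along `k^× ↪ k`,
absent from `Γ⃗^⋉_arc` — `LogEdgeLtimes.isEmpty_toSpaceLink` —, would be read as a `TB⊞`-morphism from a circle-type to a
plane-type object). [cite: MochizukiAbsTopIII2015, Cor 5.5 (iii) p. 131] -/
theorem not_exists_frozen_shapes (Vmod : Type (u + 1)) :
    ¬ ∃ (L : LogFrobeniusSetting Vmod (fun _ => true)) (v : Vmod) (R : L.Nplus v ⥤ TBPlus.{u + 1}) (x : L.X),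
      (R.obj ((L.lam v ArchVertex.mult).obj (L.log.obj x))).IsCircle ∧
        (R.obj ((L.lam v ArchVertex.pre).obj x)).IsPlane :=
  fun ⟨L, v, R, x, hmult, hpre⟩ => L.false_of_tbplus_shapes_arc v R x hmult hpre

/-! ## §5. The remaining data of abc-iut-L4-t3's add-ons at the carrier, by identities -/

/-- rows 4 → 5 as an isomorphism (field `toE` of `MonoAnalyticizationHomotopies`): the identity.
[cite: MochizukiAbsTopIII2015, Cor 5.10 p. 146] -/
def archGenuinePlus_toEIso (v : Vmod) :
    (archGenuinePlus 𝔄 Vmod isArc).monoN v ⋙ (archGenuinePlus 𝔄 Vmod isArc).toEmono v ≅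
      (archGenuinePlus 𝔄 Vmod isArc).toE v ⋙ (archGenuinePlus 𝔄 Vmod isArc).monoAn :=
  Iso.refl _

/-- rows 6 → 7 as an isomorphism (field `anToE` of `MonoAnalyticizationHomotopies`): the unit of the Prop 5.8 (vii)
equivalence `Th⊢ ⥲ An⊢` (abc-iut-w6-d025's pattern). [cite: MochizukiAbsTopIII2015, Cor 5.10 p. 146] -/
def archGenuinePlus_anToEIso :
    ((archGenuinePlus 𝔄 Vmod isArc).κAn.inverse ⋙ (archGenuinePlus 𝔄 Vmod isArc).monoAn ⋙
        (archGenuinePlus 𝔄 Vmod isArc).κAnMono.functor) ⋙ (archGenuinePlus 𝔄 Vmod isArc).κAnMono.inverse ≅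
      (archGenuinePlus 𝔄 Vmod isArc).κAn₂.functor ⋙ (archGenuinePlus 𝔄 Vmod isArc).monoAn :=
  Functor.isoWhiskerLeft
    ((archGenuinePlus 𝔄 Vmod isArc).κAn.inverse ⋙ (archGenuinePlus 𝔄 Vmod isArc).monoAn)
    (archGenuinePlus 𝔄 Vmod isArc).κAnMono.unitIso.symm

/-- "`ψ^{An⊢⊞}_{w,ν}` lies over `ℰ⊢`" as an isomorphism (field `psiOver` of `MonoTelecoreCoherence`): the identity.
[cite: MochizukiAbsTopIII2015, Prop 5.8 (vii) p. 141] -/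
def archGenuinePlus_ψOverIso (w : Vmod) (ν : {ν : LogVertex (isArc w) // ν.IsCross}) :
    (archGenuinePlus 𝔄 Vmod isArc).ψAnMono w ν ⋙ (archGenuinePlus 𝔄 Vmod isArc).forgetMono w ⋙
        (archGenuinePlus 𝔄 Vmod isArc).toEmono w ≅
      (archGenuinePlus 𝔄 Vmod isArc).κAnMono.inverse :=
  Iso.refl _

end LogFrobeniusSettingLtimes

end Literature.AnabelianGeometry.AbsoluteAnabelian

end
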